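import Summits.BirchSwinnertonDyer.Rank1Residual.ManinAdditive.CongruenceExcessCeilingLaws
import HarnessLib

/-!
# Placement edges for the congruence-excess CEILING leaves E-desc-19 / 19♯ / 20 / 21 (cell `bsd-f2-manin`),
# including the refutation of the Agashe–Ribet–Stein ceiling MODULO ONE WITNESS DATUM

PROVED, elementary edges between the `@[conjecture]` leaves of
`Summits/BirchSwinnertonDyer/Rank1Residual/ManinAdditive/CongruenceExcessCeilingLaws.lean` and the tree's
`@[conjecture]` `AgasheRibetStein2012_conjecture` (Literature `CongruenceNumber.lean`; free level `N`, doubled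
form `2·ord_p(r_E) ≤ 2·ord_p(m_E) + ord_p(N)`, no lattice clause): the data-sharp ceiling implies the repaired
ceiling; the ARS ceiling implies the repaired ceiling (`⌊v/2⌋ ≤ ⌈v/2⌉`); and — the Lean currency of the cell's
finding F-desc-ARS (refuter-1 §R32, refuter-2 v7 §K⁷, director-bsd W-50: a certified counterexample to a printed
conjecture) — the type-II law E-desc-21 together with ONE optimal datum in its regime (`TypeTwoSevenWitnessExists`,
a data statement: e.g. 1664b1; it needs a `ModularParametrizationData` term, i.e. modularity as data, which the
tree does not construct) REFUTES `AgasheRibetStein2012_conjecture`: a negative lemma modulo hypotheses, not a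
`refuted` booking. The first two edges and the shape of the third are the planner's kernel-checked sketch (HOME
`run/shared/lean/pub/bsd-f2-manin/desc/Sketch-desc-g2.lean` 5680280cec81f6ef: `congruenceExcessCeiling_of_sharp`,
`congruenceExcessCeiling_of_ars`, `not_arsCongruenceCeiling_of_typeTwo`), re-targeted from the sketch's local
restatement `ARSCongruenceCeiling` to the tree's conjecture decl (no near-duplicate is declared). Nothing new is
asserted. [cite: AgasheRibetStein2012, Conj. 2.2]
-/

noncomputable section

open scoped MatrixGroups ModularForm

open CongruenceSubgroup WeierstrassCurve
  Literature.NumberTheory.EllipticCurves Literature.NumberTheory.EllipticCurves.ModularForms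
  Literature.NumberTheory.DiophantineGeometry

namespace Summit.BirchSwinnertonDyer.Rank1Residual.ManinAdditive

/-- The sharp variant implies the repaired ceiling. [folklore] -/
theorem congruenceExcessCeiling_of_sharp (h : SharpCongruenceCeiling) : CongruenceExcessCeiling := by
  intro W _ _ _ D hL hmin p hp
  have h1 := h W D hL hmin p hp
  by_cases hc : p = 2 ∧ padicValNat 2 (W.conductorNorm ℤ) = 7
  · rw [if_pos hc] at h1
    obtain ⟨rfl, h7⟩ := hc
    rw [h7]; omega
  · rw [if_neg hc] at h1
    have h2 : padicValNat p (W.conductorNorm ℤ) / 2 ≤ (padicValNat p (W.conductorNorm ℤ) + 1) / 2 :=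
      Nat.div_le_div_right (Nat.le_succ _)
    omega

/-- The Agashe–Ribet–Stein ceiling (tree `AgasheRibetStein2012_conjecture`, doubled form at free level,
instantiated at the conductor level) implies the repaired ceiling (`⌊v/2⌋ ≤ ⌈v/2⌉`).
[cite: AgasheRibetStein2012, Conj. 2.2] -/
theorem congruenceExcessCeiling_of_agasheRibetStein (h : AgasheRibetStein2012_conjecture) :
    CongruenceExcessCeiling := by
  intro W _ _ _ D _hL hmin p hp
  have h1 := h W (W.conductorNorm ℤ) D hmin p hp
  omega

/-- Existence of ONE optimal curve in the regime of E-desc-21 (e.g. `1664b1`: `N = 2⁷·13`, Kodaira type II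
at `2`, `E[2]` irreducible): a DATA statement the cell cannot yet discharge in Lean — it needs a
`ModularParametrizationData` term (modularity as data). Hypothesis schema; nothing asserted. [folklore] -/
def TypeTwoSevenWitnessExists : Prop :=
  ∃ (W : WeierstrassCurve ℚ) (_ : W.IsElliptic) (_ : W.IsGloballyMinimal)
    (_ : NeZero (W.conductorNorm ℤ)) (D : ModularParametrizationData W (W.conductorNorm ℤ)),
    (∀ z ∈ D.L.lattice, ∃ w ∈ periodLattice D.f, z = D.c * w) ∧
    (∀ (W' : WeierstrassCurve ℚ) [W'.IsElliptic]
        (D' : ModularParametrizationData W' (W.conductorNorm ℤ)),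
        D'.f = D.f → D.modularDegree ≤ D'.modularDegree) ∧
    padicValNat 2 (W.conductorNorm ℤ) = 7 ∧
      W.kodairaSymbolAt ((Rat.HeightOneSpectrum.primesEquiv (R := ℤ)).symm ⟨2, Nat.prime_two⟩) =
        KodairaSymbol.II ∧
      W.HasIrreducibleModPGaloisRep 2

/-- **Placement edge (PROVED) — the Lean currency of the finding F-desc-ARS:** the type-II law at `v₂ = 7`
(E-desc-21) and one optimal datum in its regime refute the Agashe–Ribet–Stein ceiling (tree
`AgasheRibetStein2012_conjecture`) as a universal statement: at that datum `2·ord₂(r_E) = 2·ord₂(m_E) + 8 >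
2·ord₂(m_E) + 7`. A negative lemma modulo its two hypotheses; the certified finite computation behind them is
refuter-1 §R32 (26/26 curves, three engines). [cite: AgasheRibetStein2012, Conj. 2.2] -/
theorem not_agasheRibetStein2012_conjecture_of_typeTwo (h : DyadicTypeTwoExcessFour)
    (hw : TypeTwoSevenWitnessExists) : ¬ AgasheRibetStein2012_conjecture := by
  intro hars
  obtain ⟨W, _, _, _, D, hL, hmin, hv, hK, hI⟩ := hw
  have h4 := h W D hL hmin hv hK hI
  have h3 := hars W (W.conductorNorm ℤ) D hmin 2 Nat.prime_two
  rw [hv] at h3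
  omega

/-- Hence, granted the type-II law and one witness, the sketch-level implication «ARS ⇒ repaired ceiling» is
vacuous and the repaired / sharp ceilings are the live statements. The sharp ceiling is consistent with the
type-II law: at `(2, 7)` it allows exactly `x₂ ≤ 4`. [folklore] -/
theorem sharpCongruenceCeiling_typeTwo_le (hs : SharpCongruenceCeiling)
    (W : WeierstrassCurve ℚ) [W.IsElliptic] [W.IsGloballyMinimal] [NeZero (W.conductorNorm ℤ)]
    (D : ModularParametrizationData W (W.conductorNorm ℤ))
    (hL : ∀ z ∈ D.L.lattice, ∃ w ∈ periodLattice D.f, z = D.c * w)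
    (hmin : ∀ (W' : WeierstrassCurve ℚ) [W'.IsElliptic]
        (D' : ModularParametrizationData W' (W.conductorNorm ℤ)),
        D'.f = D.f → D.modularDegree ≤ D'.modularDegree)
    (hv : padicValNat 2 (W.conductorNorm ℤ) = 7) :
    padicValNat 2 (congruenceNumber D.f) ≤ padicValNat 2 D.modularDegree + 4 := by
  have h1 := hs W D hL hmin 2 Nat.prime_two
  rwa [if_pos ⟨rfl, hv⟩] at h1

end Summit.BirchSwinnertonDyer.Rank1Residual.ManinAdditive

end
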